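import Mathlib
import Summits.Ventures.PercRepro2.Defs
import Summits.Ventures.PercRepro2.Graph
import Summits.Ventures.PercRepro2.OneColourSwitch
import Summits.Ventures.PercRepro2.RegionHubSign
import Summits.Ventures.PercRepro2.SideSwitch
import Summits.Ventures.PercRepro2.SideSwitchFibre
import Summits.Ventures.PercRepro2.SideSwitchClosed
import Summits.Ventures.PercRepro2.SideSwitchComps
import Summits.Ventures.PercRepro2.TermSwitchDefs

/-!
# The outside flip, the representatives and the components for a terminal set (blind cell
PercRepro2, p3 g21, 2026-08-27; `proofs/P3-CPNC.md` §18b (i), (iii))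

For a terminal set `H`: the outside `O_H = (K_H ∪ M_H)ᶜ` and the flip of the edges inside it
(`flipIn`), which fixes both worlds and every connection between terminals
(`KH_flipIn_OsetH`, `sigma_flipIn_OsetH`); the sided vertices `A0H`, the `W`-side `BsideH`, the
representatives `RepH` (`sepH`-colourings with `M_H ⊆ H`), the normalisation `nuH`; and the
components `compsH` of the sided set (the clusters of `chi` on `A0H`, `SideSwitchComps`), with
their partition and closedness lemmas.  Own work; std axioms.
-/

namespace Summit.Ventures.PercRepro2

namespace TermSwitch

open Finset Classical RegionHub OneColourSwitch SideSwitch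

variable {V : Type*} {E : Type*}

section Outside

variable (ends : E → Sym2 V)

/-- The outside of `K_H ∪ M_H`. -/
def OsetH (H : Set V) (ω : Config E) : Set V := (KH ends H ω ∪ MH ends H ω)ᶜ

variable {ends}

/-- The outside is invariant under the colour flip. -/
lemma OsetH_compl (H : Set V) (ω : Config E) :
    OsetH ends H (OneColourSwitch.compl ω) = OsetH ends H ω := by
  simp only [OsetH, KH_compl, MH_compl, Set.union_comm]

/-- An edge touching `K_H ∪ M_H` is not inside the outside. -/
lemma not_mem_within_OsetH_of_mem_touches {H : Set V} {ω : Config E} {e : E}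
    (he : e ∈ touches ends (KH ends H ω ∪ MH ends H ω)) :
    e ∉ within ends (OsetH ends H ω) := by
  rintro ⟨x, hx, y, hy, hends⟩
  obtain ⟨z, hz, w, hzw⟩ := he
  rw [hends, Sym2.eq_iff] at hzw
  rcases hzw with ⟨rfl, _⟩ | ⟨_, rfl⟩
  · exact hx hz
  · exact hy hz

/-- The `Y`-world ignores the edges inside the outside. -/
lemma KH_flipIn_OsetH (H : Set V) (ω : Config E) :
    KH ends H (flipIn ends (OsetH ends H ω) ω) = KH ends H ω := by
  apply expl_eq_of_eqOn_touches
  intro e he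
  obtain ⟨x, hx, y, hxy⟩ := he
  have hnot : e ∉ within ends (OsetH ends H ω) :=
    not_mem_within_OsetH_of_mem_touches ⟨x, Or.inl hx, y, hxy⟩
  rw [flipIn_of_notMem hnot]

/-- The `W`-world ignores the edges inside the outside. -/
lemma MH_flipIn_OsetH (H : Set V) (ω : Config E) :
    MH ends H (flipIn ends (OsetH ends H ω) ω) = MH ends H ω := by
  rw [MH, compl_flipIn, ← KH, ← OsetH_compl, KH_flipIn_OsetH, KH_compl]

/-- The outside is preserved by the outside flip. -/
lemma OsetH_flipIn (H : Set V) (ω : Config E) :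
    OsetH ends H (flipIn ends (OsetH ends H ω) ω) = OsetH ends H ω := by
  show (KH ends H (flipIn ends (OsetH ends H ω) ω) ∪
    MH ends H (flipIn ends (OsetH ends H ω) ω))ᶜ = OsetH ends H ω
  rw [KH_flipIn_OsetH, MH_flipIn_OsetH]
  rfl

/-- The cluster of a terminal ignores the edges inside the outside. -/
lemma cluster_flipIn_OsetH {H : Set V} {h : V} (hh : h ∈ H) (ω : Config E) :
    cluster ends (flipIn ends (OsetH ends H ω) ω) h = cluster ends ω h := by
  refine cluster_eq_of_eqOn_touches (ω := ω) ?_ rfl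
  intro e he
  obtain ⟨x, hx, y, hxy⟩ := he
  have hxK : x ∈ KH ends H ω := ⟨h, hh, hx⟩
  have hnot : e ∉ within ends (OsetH ends H ω) :=
    not_mem_within_OsetH_of_mem_touches ⟨x, Or.inl hxK, y, hxy⟩
  rw [flipIn_of_notMem hnot]

/-- A `Y`-connection from a terminal ignores the edges inside the outside. -/
lemma conn_flipIn_OsetH {H : Set V} {r : V} (hr : r ∈ H) (s : V) (ω : Config E) :
    Conn ends (flipIn ends (OsetH ends H ω) ω) r s ↔ Conn ends ω r s := by
  have h := cluster_flipIn_OsetH (ends := ends) hr ω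
  constructor
  · intro hc
    have : s ∈ cluster ends (flipIn ends (OsetH ends H ω) ω) r := hc
    rw [h] at this
    exact this
  · intro hc
    have : s ∈ cluster ends ω r := hc
    rw [← h] at this
    exact this

/-- A `W`-connection from a terminal ignores the edges inside the outside. -/
lemma conn_compl_flipIn_OsetH {H : Set V} {r : V} (hr : r ∈ H) (s : V) (ω : Config E) :
    Conn ends (OneColourSwitch.compl (flipIn ends (OsetH ends H ω) ω)) r s ↔
      Conn ends (OneColourSwitch.compl ω) r s := by
  rw [compl_flipIn, ← OsetH_compl]
  exact conn_flipIn_OsetH hr s (OneColourSwitch.compl ω)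

/-- `σ_rs` ignores the edges inside the outside when `r` is a terminal. -/
lemma sigma_flipIn_OsetH {H : Set V} {r : V} (hr : r ∈ H) (s : V) (ω : Config E) :
    sigma ends (flipIn ends (OsetH ends H ω) ω) r s = sigma ends ω r s := by
  unfold sigma
  simp only [conn_flipIn_OsetH hr, conn_compl_flipIn_OsetH hr]

end Outside

section Count

variable [Fintype V] [DecidableEq V]

variable (ends : E → Sym2 V)

/-- The sided vertices of `H` as a finset. -/
noncomputable def A0H (H : Set V) (ω : Config E) : Finset V :=
  univ.filter (fun x => (x ∈ KH ends H ω ∪ MH ends H ω) ∧ x ∉ H)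

/-- The `W`-side: the sided vertices of the `W`-world. -/
noncomputable def BsideH (H : Set V) (ω : Config E) : Finset V :=
  univ.filter (fun x => x ∈ MH ends H ω ∧ x ∉ H)

/-- The components of the sided set of `ω`. -/
noncomputable def compsH (H : Set V) (ω : Config E) : Finset (Finset V) :=
  (A0H ends H ω).image (compIn ends (↑(A0H ends H ω) : Set V))

/-- The normalisation: switch the whole `W`-side to the `Y`-side. -/
noncomputable def nuH (H : Set V) (ω : Config E) : Config E :=
  flipTouch ends (↑(BsideH ends H ω) : Set V) ω

variable {ends}

omit [DecidableEq V] in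
/-- Membership in `A0H`. -/
lemma mem_A0H {H : Set V} {ω : Config E} {x : V} :
    x ∈ A0H ends H ω ↔ (x ∈ KH ends H ω ∪ MH ends H ω) ∧ x ∉ H := by
  simp [A0H]

omit [DecidableEq V] in
/-- Membership in the `W`-side. -/
lemma mem_BsideH {H : Set V} {ω : Config E} {x : V} :
    x ∈ BsideH ends H ω ↔ x ∈ MH ends H ω ∧ x ∉ H := by
  simp [BsideH]

omit [DecidableEq V] in
/-- The sided set is the coercion of `A0H`. -/
lemma sidedH_eq_coe_A0H (H : Set V) (ω : Config E) :
    sidedH ends H ω = (↑(A0H ends H ω) : Set V) := by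
  ext x
  rw [Finset.mem_coe, mem_A0H]
  exact Iff.rfl

omit [DecidableEq V] in
/-- The `W`-side is a set of sided vertices. -/
lemma BsideH_subset_A0H (H : Set V) (ω : Config E) : BsideH ends H ω ⊆ A0H ends H ω := by
  intro x hx
  rw [mem_BsideH] at hx
  exact mem_A0H.2 ⟨Or.inr hx.1, hx.2⟩

omit [DecidableEq V] in
/-- The hypotheses of the switch lemma for a subset of `A0H`. -/
lemma subset_UH_of_subset_A0H {H : Set V} {ω : Config E} {T : Finset V}
    (hT : T ⊆ A0H ends H ω) :
    (↑T : Set V) ⊆ KH ends H ω ∪ MH ends H ω ∧ ∀ x ∈ (↑T : Set V), x ∉ H :=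
  ⟨fun _ hx => (mem_A0H.1 (hT hx)).1, fun _ hx => (mem_A0H.1 (hT hx)).2⟩

omit [DecidableEq V] in
/-- `A0H` is preserved by the outside flip. -/
lemma A0H_flipIn_OsetH (H : Set V) (ω : Config E) :
    A0H ends H (flipIn ends (OsetH ends H ω) ω) = A0H ends H ω := by
  ext x
  simp only [mem_A0H, KH_flipIn_OsetH, MH_flipIn_OsetH]

/-! ## The components -/

/-- Every component of `ω` is the component of each of its vertices. -/
lemma eq_compIn_of_mem_compsH {H : Set V} {ω : Config E} {C : Finset V}
    (hC : C ∈ compsH ends H ω) {x : V} (hx : x ∈ C) :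
    C = compIn ends (↑(A0H ends H ω) : Set V) x := by
  obtain ⟨y, _, rfl⟩ := Finset.mem_image.1 hC
  exact (compIn_eq_of_mem hx).symm

/-- A component is a subset of `A0H`. -/
lemma subset_A0H_of_mem_compsH {H : Set V} {ω : Config E} {C : Finset V}
    (hC : C ∈ compsH ends H ω) : C ⊆ A0H ends H ω := by
  obtain ⟨y, hy, rfl⟩ := Finset.mem_image.1 hC
  exact fun z hz => Finset.mem_coe.1 (mem_of_mem_compIn (Finset.mem_coe.2 hy) hz)

/-- A component is closed inside the sided set. -/
lemma closedIn_of_mem_compsH {H : Set V} {ω : Config E} {C : Finset V}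
    (hC : C ∈ compsH ends H ω) : ClosedIn ends (sidedH ends H ω) (↑C : Set V) := by
  obtain ⟨y, hy, rfl⟩ := Finset.mem_image.1 hC
  rw [sidedH_eq_coe_A0H]
  exact closedIn_compIn (Finset.mem_coe.2 hy)

/-- A union of components is a subset of `A0H`. -/
lemma unionT_subset_A0H {H : Set V} {ω : Config E} {T : Finset (Finset V)}
    (hT : T ⊆ compsH ends H ω) : unionT T ⊆ A0H ends H ω := by
  intro x hx
  obtain ⟨C, hC, hxC⟩ := mem_unionT.1 hx
  exact subset_A0H_of_mem_compsH (hT hC) hxC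

/-- A union of components is closed inside the sided set. -/
lemma closedIn_unionT_H {H : Set V} {ω : Config E} {T : Finset (Finset V)}
    (hT : T ⊆ compsH ends H ω) : ClosedIn ends (sidedH ends H ω) (↑(unionT T) : Set V) := by
  intro e a b hends ha hb
  obtain ⟨C, hC, haC⟩ := mem_unionT.1 (Finset.mem_coe.1 ha)
  exact Finset.mem_coe.2 (mem_unionT.2 ⟨C, hC, Finset.mem_coe.1
    (closedIn_of_mem_compsH (hT hC) e a b hends (Finset.mem_coe.2 haC) hb)⟩)

/-- The union of all components is `A0H`. -/
lemma unionT_compsH (H : Set V) (ω : Config E) : unionT (compsH ends H ω) = A0H ends H ω := by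
  ext x
  rw [mem_unionT]
  constructor
  · rintro ⟨C, hC, hxC⟩
    exact subset_A0H_of_mem_compsH hC hxC
  · intro hx
    exact ⟨compIn ends (↑(A0H ends H ω) : Set V) x, Finset.mem_image.2 ⟨x, hx, rfl⟩,
      mem_compIn_self _ _⟩

/-- A component contained in a union of components is one of them. -/
lemma mem_of_subset_unionT_H {H : Set V} {ω : Config E} {T : Finset (Finset V)}
    (hT : T ⊆ compsH ends H ω) {C : Finset V} (hC : C ∈ compsH ends H ω)
    (hsub : C ⊆ unionT T) : C ∈ T := by
  obtain ⟨y, hy, rfl⟩ := Finset.mem_image.1 hC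
  obtain ⟨C', hC', hyC'⟩ := mem_unionT.1 (hsub (mem_compIn_self _ y))
  have : C' = compIn ends (↑(A0H ends H ω) : Set V) y := eq_compIn_of_mem_compsH (hT hC') hyC'
  rw [← this]
  exact hC'

/-- The components inside a union of components are exactly its members. -/
lemma filter_subset_unionT_H {H : Set V} {ω : Config E} {T : Finset (Finset V)}
    (hT : T ⊆ compsH ends H ω) :
    (compsH ends H ω).filter (fun C => C ⊆ unionT T) = T := by
  ext C
  rw [Finset.mem_filter]
  constructor
  · rintro ⟨hC, hsub⟩
    exact mem_of_subset_unionT_H hT hC hsub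
  · intro hCT
    exact ⟨hT hCT, fun x hx => mem_unionT.2 ⟨C, hCT, hx⟩⟩

/-- The union of the complementary set of components is the complement in `A0H`. -/
lemma unionT_sdiff_compsH {H : Set V} {ω : Config E} {T : Finset (Finset V)}
    (hT : T ⊆ compsH ends H ω) :
    unionT (compsH ends H ω \ T) = A0H ends H ω \ unionT T := by
  ext x
  rw [mem_unionT, Finset.mem_sdiff, mem_unionT]
  constructor
  · rintro ⟨C, hC, hxC⟩
    obtain ⟨hCc, hCT⟩ := Finset.mem_sdiff.1 hC
    refine ⟨subset_A0H_of_mem_compsH hCc hxC, ?_⟩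
    rintro ⟨C', hC', hxC'⟩
    have h1 := eq_compIn_of_mem_compsH hCc hxC
    have h2 := eq_compIn_of_mem_compsH (hT hC') hxC'
    exact hCT (h1.trans h2.symm ▸ hC')
  · rintro ⟨hxA, hx⟩
    refine ⟨compIn ends (↑(A0H ends H ω) : Set V) x, Finset.mem_sdiff.2
      ⟨Finset.mem_image.2 ⟨x, hxA, rfl⟩, ?_⟩, mem_compIn_self _ _⟩
    intro hmem
    exact hx ⟨_, hmem, mem_compIn_self _ _⟩

/-- The union of a difference of component sets is the difference of the unions. -/
lemma unionT_sdiff_H {H : Set V} {ω : Config E} {T T' : Finset (Finset V)} (hTT : T ⊆ T')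
    (hT' : T' ⊆ compsH ends H ω) : unionT (T' \ T) = unionT T' \ unionT T := by
  ext x
  rw [mem_unionT, Finset.mem_sdiff, mem_unionT, mem_unionT]
  constructor
  · rintro ⟨C, hC, hxC⟩
    obtain ⟨hCT', hCT⟩ := Finset.mem_sdiff.1 hC
    refine ⟨⟨C, hCT', hxC⟩, ?_⟩
    rintro ⟨C', hC', hxC'⟩
    have h1 := eq_compIn_of_mem_compsH (hT' hCT') hxC
    have h2 := eq_compIn_of_mem_compsH (hT' (hTT hC')) hxC'
    exact hCT (h1.trans h2.symm ▸ hC')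
  · rintro ⟨⟨C, hC, hxC⟩, hx⟩
    refine ⟨C, Finset.mem_sdiff.2 ⟨hC, fun hCT => hx ⟨C, hCT, hxC⟩⟩, hxC⟩

variable [Fintype E] [DecidableEq E]

variable (ends)

/-- The `sepH`-colourings. -/
noncomputable def SepSetH (p q : V) (H : Set V) : Finset (Config E) :=
  univ.filter (fun ω => sepH ends p q H ω)

/-- The representatives: `sepH`-colourings with every sided vertex on the `Y`-side. -/
noncomputable def RepH (p q : V) (H : Set V) : Finset (Config E) :=
  univ.filter (fun ω => sepH ends p q H ω ∧ ∀ x ∈ MH ends H ω, x ∈ H)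

variable {ends}

omit [Fintype V] [DecidableEq V] in
/-- Membership in the `sepH`-colourings. -/
lemma mem_SepSetH {p q : V} {H : Set V} {ω : Config E} :
    ω ∈ SepSetH ends p q H ↔ sepH ends p q H ω := by
  simp [SepSetH]

omit [DecidableEq V] in
/-- Membership in the representatives. -/
lemma mem_RepH {p q : V} {H : Set V} {ω : Config E} :
    ω ∈ RepH ends p q H ↔ sepH ends p q H ω ∧ ∀ x ∈ MH ends H ω, x ∈ H := by
  simp [RepH]

omit [DecidableEq V] in
/-- For a representative, `A0H ⊆ K_H`. -/
lemma A0H_subset_KH_of_mem_RepH {p q : V} {H : Set V} {ρ : Config E}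
    (hρ : ρ ∈ RepH ends p q H) {x : V} (hx : x ∈ A0H ends H ρ) : x ∈ KH ends H ρ := by
  obtain ⟨_, hM⟩ := mem_RepH.1 hρ
  obtain ⟨hU, hxH⟩ := mem_A0H.1 hx
  rcases hU with hK | hM'
  · exact hK
  · exact (hxH (hM x hM')).elim

omit [DecidableEq V] in
/-- The outside flip preserves the representatives. -/
lemma flipIn_mem_RepH {p q : V} {H : Set V} {ρ : Config E} (hρ : ρ ∈ RepH ends p q H) :
    flipIn ends (OsetH ends H ρ) ρ ∈ RepH ends p q H := by
  obtain ⟨h, hM⟩ := mem_RepH.1 hρ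
  rw [mem_RepH, sepH, KH_flipIn_OsetH, MH_flipIn_OsetH]
  exact ⟨h, hM⟩

end Count

end TermSwitch

end Summit.Ventures.PercRepro2
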